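import Summits.CriticalPhenomena.PercolationContinuityZ3.Theorems.SahiAEBorelVersionPos
import Summits.CriticalPhenomena.PercolationContinuityZ3.Theorems.SahiAEVersionTransport
import Summits.CriticalPhenomena.PercolationContinuityZ3.Theorems.SahiAEBoxExtension

/-!
# Uniformly positive Borel everywhere-MTP₂ versions: the property, its transport, Lebesgue measure, the open cube

Support file of the Sahi cell (`prim-sahi`, typer seat, generation 22; `--supports stmt-CriticalPhenomena-4575`).
One definition (`HasPosBorelMTP2Versions`), theorems otherwise; no named facts, no sorries.

`SahiAEVersionTransport*.lean` (typer g21) transport the Borel-version property `HasBorelMTP2Versions` (versions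
bounded ABOVE) from Lebesgue measure to every finite product of σ-finite measures on `ℝ`; the transported versions
vanish off a null set (`𝟙_S · (F' ∘ R)`, and the open-cube step).  `SahiAEBorelVersionPos.lean` (typer g21) gives
TWO-SIDED bounds `0 < c' ≤ F ≤ M' < ∞` for Lebesgue measure.  This file starts the transport of the two-sided
property:

* `HasPosBorelMTP2Versions μ` — every measurable `f : α → [c, M]` (`0 < c`, `M < ∞`) MTP₂ on `μ ⊗ μ`-a.e. pair has
  a measurable version `F`, `0 < c' ≤ F ≤ M' < ∞`, MTP₂ at EVERY pair; `.hasBorelMTP2Versions` (forget the lower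
  bound);
* `HasPosBorelMTP2Versions.transport` — transport along `T : α → β` (a.e. lattice homomorphism, `T_* μ ∼ ν`) with a
  right inverse `R : β → α` which is a lattice homomorphism EVERYWHERE (then no indicator is needed and the bounds
  survive: the version of `f` is `F' ∘ R`); `.of_equivalent`, `hasPosBorelMTP2Versions_zero`;
* `hasPosBorelMTP2Versions_volume` — Lebesgue measure on `ℝ^ι` (`exists_pos_measurable_mtp2_version_of_ae`);
* `HasPosBorelMTP2Versions.restrict_openUnitCube` — Lebesgue measure on the open unit cube `(0,1)^ι`, with a version
  that is positive and MTP₂ at every pair of `ℝ^ι` (not only of the cube): the pull-back `F'' ∘ logit` of a positive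
  Lebesgue version is MTP₂ on the pairs of the OPEN cube only, and is EXTENDED across the faces by
  `exists_mtp2_extension_of_openUnitCube` (`SahiAEBoxExtension.lean`).  This is the step where the g21 chain lost
  positivity.

The atoms / σ-finite product steps and the unfolded corollaries are in `SahiAEBorelVersionPosPi.lean`.
No sorries, no new axioms.
-/

noncomputable section

namespace Summit.CriticalPhenomena.PercolationContinuityZ3.Theorems.SahiAEFourFunctions

open MeasureTheory Set Filter Topology ProbabilityTheory
open scoped ENNReal NNReal

/-! ### The two-sided property and its transport -/

section Transport

/-- **The two-sided Borel-version property** of a reference measure `μ` on a measurable lattice `α`: every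
measurable `f : α → [0,∞]` with `0 < c ≤ f ≤ M < ∞` which is MTP₂ for `μ ⊗ μ`-almost every pair has a measurable
version `F = f` `μ`-a.e. with two-sided bounds `0 < c' ≤ F ≤ M' < ∞` which is MTP₂ at EVERY pair. [this work] -/
def HasPosBorelMTP2Versions {α : Type*} [MeasurableSpace α] [Lattice α] (μ : Measure α) : Prop :=
  ∀ (f : α → ℝ≥0∞), Measurable f → ∀ (c M : ℝ≥0∞), c ≠ 0 → M ≠ ∞ → (∀ x, c ≤ f x) → (∀ x, f x ≤ M) →
    (∀ᵐ p ∂μ.prod μ, f p.1 * f p.2 ≤ f (p.1 ⊓ p.2) * f (p.1 ⊔ p.2)) →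
    ∃ F : α → ℝ≥0∞, Measurable F ∧ (∃ c' M' : ℝ≥0∞, c' ≠ 0 ∧ M' ≠ ∞ ∧ ∀ x, c' ≤ F x ∧ F x ≤ M') ∧ F =ᵐ[μ] f ∧
      ∀ x y, F x * F y ≤ F (x ⊓ y) * F (x ⊔ y)

variable {α β : Type*} [MeasurableSpace α] [MeasurableSpace β] [Lattice α] [Lattice β]

/-- The two-sided property implies the one-sided one of `SahiAEVersionTransport`. [this work] -/
theorem HasPosBorelMTP2Versions.hasBorelMTP2Versions {μ : Measure α} (hP : HasPosBorelMTP2Versions μ) :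
    HasBorelMTP2Versions μ := by
  intro f hf c M hc hM hcf hfM hMTP
  obtain ⟨F, hFm, ⟨c', M', _, hM', hFb⟩, hFf, hFmtp⟩ := hP f hf c M hc hM hcf hfM hMTP
  exact ⟨F, hFm, ⟨M', hM', fun x => (hFb x).2⟩, hFf, hFmtp⟩

/-- **Transport lemma, two-sided form.**  Let `T : α → β`, `R : β → α` be measurable, `T` a lattice homomorphism
on `μ ⊗ μ`-almost every pair, `ν ≪ T_* μ ≪ ν`, `R` a lattice homomorphism at EVERY pair, and `R (T x) = x` for
`μ`-a.e. `x`.  If `μ` has the two-sided Borel-version property, so does `ν`: the version of `f` is `F' ∘ R` for a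
version `F'` of `f ∘ T`, with the same bounds. [this work] -/
theorem HasPosBorelMTP2Versions.transport {μ : Measure α} {ν : Measure β} [SFinite μ] [SFinite ν]
    (hP : HasPosBorelMTP2Versions μ) {T : α → β} {R : β → α} (hT : Measurable T) (hR : Measurable R)
    (hTlat : ∀ᵐ p ∂μ.prod μ, T (p.1 ⊓ p.2) = T p.1 ⊓ T p.2 ∧ T (p.1 ⊔ p.2) = T p.1 ⊔ T p.2)
    (hνT : ν ≪ μ.map T) (hTν : μ.map T ≪ ν) (hRlat : ∀ x y, R (x ⊓ y) = R x ⊓ R y ∧ R (x ⊔ y) = R x ⊔ R y)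
    (hRT : ∀ᵐ x ∂μ, R (T x) = x) : HasPosBorelMTP2Versions ν := by
  intro f hf c M hc hM hcf hfM hMTP
  have hqmp : Measure.QuasiMeasurePreserving T μ ν := ⟨hT, hTν⟩
  have hqmp2 : Measure.QuasiMeasurePreserving (Prod.map T T) (μ.prod μ) (ν.prod ν) :=
    MeasureTheory.QuasiMeasurePreserving.prodMap hqmp hqmp
  have hMTP' : ∀ᵐ p ∂μ.prod μ, f (T p.1) * f (T p.2) ≤ f (T (p.1 ⊓ p.2)) * f (T (p.1 ⊔ p.2)) := by
    filter_upwards [hqmp2.ae hMTP, hTlat] with p hp hl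
    rw [hl.1, hl.2]
    exact hp
  obtain ⟨F', hF'm, ⟨c', M', hc', hM', hF'b⟩, hF'ae, hF'mtp⟩ :=
    hP (f ∘ T) (hf.comp hT) c M hc hM (fun x => hcf (T x)) (fun x => hfM (T x)) hMTP'
  refine ⟨F' ∘ R, hF'm.comp hR, ⟨c', M', hc', hM', fun x => hF'b (R x)⟩, ?_, fun x y => ?_⟩
  · have h1 : ∀ᵐ x ∂μ, F' (R (T x)) = f (T x) := by
      filter_upwards [hF'ae, hRT] with x hx hxR
      rw [hxR]; exact hx
    have h2 : ∀ᵐ y ∂μ.map T, F' (R y) = f y :=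
      (ae_map_iff hT.aemeasurable (measurableSet_eq_fun (hF'm.comp hR) hf)).2 h1
    exact hνT.ae_le h2
  · simp only [Function.comp_apply]
    rw [(hRlat x y).1, (hRlat x y).2]
    exact hF'mtp (R x) (R y)

/-- Equivalent reference measures have the two-sided property simultaneously. [this work] -/
theorem HasPosBorelMTP2Versions.of_equivalent {μ ν : Measure α} [SFinite μ] [SFinite ν]
    (hP : HasPosBorelMTP2Versions μ) (hνμ : ν ≪ μ) (hμν : μ ≪ ν) : HasPosBorelMTP2Versions ν :=
  hP.transport (T := id) (R := id) measurable_id measurable_id (Eventually.of_forall fun _ => ⟨rfl, rfl⟩)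
    (by rwa [Measure.map_id]) (by rwa [Measure.map_id]) (fun _ _ => ⟨rfl, rfl⟩) (Eventually.of_forall fun _ => rfl)

/-- The zero measure has the property trivially (the constant version `1`). [folklore] -/
theorem hasPosBorelMTP2Versions_zero : HasPosBorelMTP2Versions (0 : Measure α) := by
  intro f _ c M _ _ _ _ _
  exact ⟨fun _ => 1, measurable_const, ⟨1, 1, one_ne_zero, ENNReal.one_ne_top, fun _ => ⟨le_rfl, le_rfl⟩⟩,
    ae_zero.le (by simp), fun _ _ => le_rfl⟩

end Transport

/-! ### Lebesgue measure on `ℝ^ι` -/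

section Volume

variable {ι : Type*} [Fintype ι]

/-- **Lebesgue measure on `ℝ^ι` has the two-sided Borel-version property** (typer g21,
`exists_pos_measurable_mtp2_version_of_ae`: separable tilt + lower-corner envelope with its lower bound). [this work] -/
theorem hasPosBorelMTP2Versions_volume : HasPosBorelMTP2Versions (volume : Measure (ι → ℝ)) :=
  fun f hf _ _ hc hM hcf hfM hMTP => exists_pos_measurable_mtp2_version_of_ae f hf hc hM hcf hfM hMTP

end Volume

/-! ### The open unit cube: pull back, then EXTEND across the faces -/

section OpenCube

variable {ι : Type*} [Fintype ι]

/-- `sigmoid (log (v * (1 - v)⁻¹)) = v` on `(0,1)`. [folklore] -/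
private theorem sigmoid_log_div' {v : ℝ} (hv : v ∈ Ioo (0 : ℝ) 1) : Real.sigmoid (Real.log (v * (1 - v)⁻¹)) = v := by
  have hv0 : 0 < v := hv.1
  have hv1 : 0 < 1 - v := by linarith [hv.2]
  rw [Real.sigmoid_def, Real.exp_neg, Real.exp_log (mul_pos hv0 (inv_pos.2 hv1))]
  field_simp
  ring

/-- `log (sigmoid x / (1 - sigmoid x)) = x`. [folklore] -/
private theorem log_div_sigmoid' (x : ℝ) : Real.log (Real.sigmoid x * (1 - Real.sigmoid x)⁻¹) = x :=
  Real.sigmoid_injective (sigmoid_log_div' ⟨Real.sigmoid_pos x, Real.sigmoid_lt_one x⟩)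

/-- The logit is monotone on `(0,1)`. [folklore] -/
private theorem log_div_le_log_div' {u v : ℝ} (hu : u ∈ Ioo (0 : ℝ) 1) (hv : v ∈ Ioo (0 : ℝ) 1) (huv : u ≤ v) :
    Real.log (u * (1 - u)⁻¹) ≤ Real.log (v * (1 - v)⁻¹) := by
  rw [← Real.sigmoid_le_iff, sigmoid_log_div' hu, sigmoid_log_div' hv]
  exact huv

/-- **Lebesgue on `ℝ^ι` ⟹ Lebesgue on the open unit cube, two-sided form.**  The versions produced are positive and
MTP₂ at every pair of `ℝ^ι`: a positive Lebesgue version `F''` of `f ∘ sigmoid^⊗` is pulled back along the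
coordinatewise logit (a lattice homomorphism of the OPEN cube onto `ℝ^ι`), which gives a function MTP₂ on the pairs of
the open cube, and this is extended across the faces by `exists_mtp2_extension_of_openUnitCube`. [this work] -/
theorem HasPosBorelMTP2Versions.restrict_openUnitCube (hP : HasPosBorelMTP2Versions (volume : Measure (ι → ℝ))) :
    HasPosBorelMTP2Versions ((volume : Measure (ι → ℝ)).restrict (Set.pi univ fun _ => Ioo (0 : ℝ) 1)) := by
  intro f hf c M hc hM hcf hfM hMTP
  set U : Set (ι → ℝ) := Set.pi univ fun _ => Ioo (0 : ℝ) 1 with hU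
  have mU : MeasurableSet U := MeasurableSet.univ_pi fun _ => measurableSet_Ioo
  set e : (ι → ℝ) → (ι → ℝ) := fun x i => Real.sigmoid (x i) with he
  set L : (ι → ℝ) → (ι → ℝ) := fun y i => Real.log (y i * (1 - y i)⁻¹) with hL
  have he_meas : Measurable e :=
    measurable_pi_iff.2 fun i => continuous_sigmoid.measurable.comp (measurable_pi_apply i)
  have hL_meas : Measurable L :=
    measurable_pi_iff.2 fun i => Real.measurable_log.comp
      ((measurable_pi_apply i).mul (measurable_const.sub (measurable_pi_apply i)).inv)
  have he_mem : ∀ x, e x ∈ U := fun x => Set.mem_univ_pi.2 fun i => ⟨Real.sigmoid_pos _, Real.sigmoid_lt_one _⟩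
  have hLe : ∀ x, L (e x) = x := fun x => funext fun i => log_div_sigmoid' (x i)
  have heL : ∀ y ∈ U, e (L y) = y := fun y hy => funext fun i => sigmoid_log_div' (Set.mem_univ_pi.1 hy i)
  -- differentiability, hence preservation of null sets both ways
  have he_diff : Differentiable ℝ e :=
    differentiable_pi.2 fun i => differentiable_sigmoid.comp (differentiable_apply i)
  have hL_diff : DifferentiableOn ℝ L U := by
    refine differentiableOn_pi.2 fun i => ?_
    have h1 : DifferentiableOn ℝ (fun y : ι → ℝ => y i) U := (differentiable_apply i).differentiableOn
    have h2 : DifferentiableOn ℝ (fun y : ι → ℝ => 1 - y i) U :=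
      ((differentiable_const (1 : ℝ)).sub (differentiable_apply i)).differentiableOn
    refine (h1.mul (h2.inv fun y hy => ?_)).log fun y hy => ?_
    · have := (Set.mem_univ_pi.1 hy i).2; linarith
    · have h0 := (Set.mem_univ_pi.1 hy i).1
      have h1' : 0 < 1 - y i := by have := (Set.mem_univ_pi.1 hy i).2; linarith
      exact (mul_pos h0 (inv_pos.2 h1')).ne'
  have hν : (volume : Measure (ι → ℝ)).restrict U ≪ (volume : Measure (ι → ℝ)).map e := by
    refine Measure.AbsolutelyContinuous.mk fun s hs h0 => ?_
    rw [Measure.map_apply he_meas hs] at h0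
    rw [Measure.restrict_apply hs]
    have hsub : s ∩ U ⊆ e '' (e ⁻¹' s) := fun y hy => ⟨L y, by
      show e (L y) ∈ s
      rw [heL y hy.2]; exact hy.1, heL y hy.2⟩
    exact measure_mono_null hsub
      (addHaar_image_eq_zero_of_differentiableOn_of_addHaar_eq_zero volume he_diff.differentiableOn h0)
  have hν' : (volume : Measure (ι → ℝ)).map e ≪ (volume : Measure (ι → ℝ)).restrict U := by
    refine Measure.AbsolutelyContinuous.mk fun s hs h0 => ?_
    rw [Measure.restrict_apply hs] at h0
    rw [Measure.map_apply he_meas hs]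
    have hsub : e ⁻¹' s ⊆ L '' (s ∩ U) := fun x hx => ⟨e x, ⟨hx, he_mem x⟩, hLe x⟩
    exact measure_mono_null hsub
      (addHaar_image_eq_zero_of_differentiableOn_of_addHaar_eq_zero volume
        (hL_diff.mono Set.inter_subset_right) h0)
  -- lattice properties
  have helat : ∀ x y, e (x ⊓ y) = e x ⊓ e y ∧ e (x ⊔ y) = e x ⊔ e y := fun x y =>
    ⟨funext fun i => Real.sigmoid_monotone.map_inf (x i) (y i),
      funext fun i => Real.sigmoid_monotone.map_sup (x i) (y i)⟩
  have hLlat : ∀ x ∈ U, ∀ y ∈ U, L (x ⊓ y) = L x ⊓ L y ∧ L (x ⊔ y) = L x ⊔ L y := by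
    intro x hx y hy
    have hmono : MonotoneOn (fun v : ℝ => Real.log (v * (1 - v)⁻¹)) (Ioo (0 : ℝ) 1) :=
      fun u hu v hv huv => log_div_le_log_div' hu hv huv
    refine ⟨funext fun i => ?_, funext fun i => ?_⟩
    · exact hmono.map_inf (Set.mem_univ_pi.1 hx i) (Set.mem_univ_pi.1 hy i)
    · exact hmono.map_sup (Set.mem_univ_pi.1 hx i) (Set.mem_univ_pi.1 hy i)
  -- the pulled-back density `f ∘ e` on `ℝ^ι`
  have hqmp : Measure.QuasiMeasurePreserving e volume ((volume : Measure (ι → ℝ)).restrict U) := ⟨he_meas, hν'⟩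
  have hqmp2 := MeasureTheory.QuasiMeasurePreserving.prodMap hqmp hqmp
  have hMTP' : ∀ᵐ p ∂(volume : Measure (ι → ℝ)).prod volume,
      f (e p.1) * f (e p.2) ≤ f (e (p.1 ⊓ p.2)) * f (e (p.1 ⊔ p.2)) := by
    filter_upwards [hqmp2.ae hMTP] with p hp
    rw [(helat p.1 p.2).1, (helat p.1 p.2).2]
    exact hp
  obtain ⟨F'', hF''m, ⟨c'', M'', hc'', hM'', hF''b⟩, hF''ae, hF''mtp⟩ :=
    hP (f ∘ e) (hf.comp he_meas) c M hc hM (fun x => hcf (e x)) (fun x => hfM (e x)) hMTP'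
  -- `F'' ∘ L`: two-sided bounds everywhere, MTP₂ on the pairs of the open cube; extend across the faces
  have hGmtp : ∀ x ∈ U, ∀ y ∈ U, F'' (L x) * F'' (L y) ≤ F'' (L (x ⊓ y)) * F'' (L (x ⊔ y)) := by
    intro x hx y hy
    rw [(hLlat x hx y hy).1, (hLlat x hx y hy).2]
    exact hF''mtp (L x) (L y)
  obtain ⟨G, hGm, hGb, hGeq, hGmtp⟩ := exists_mtp2_extension_of_openUnitCube (fun y => F'' (L y)) (hF''m.comp hL_meas)
    hc'' hM'' (fun y => (hF''b (L y)).1) (fun y => (hF''b (L y)).2) hGmtp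
  refine ⟨G, hGm, hGb, ?_, hGmtp⟩
  -- `G = f` almost everywhere on the cube
  have h1 : ∀ᵐ x ∂(volume : Measure (ι → ℝ)), F'' (L (e x)) = f (e x) := by
    filter_upwards [hF''ae] with x hx
    rw [hLe x]; exact hx
  have h2 : ∀ᵐ y ∂(volume : Measure (ι → ℝ)).map e, F'' (L y) = f y :=
    (ae_map_iff he_meas.aemeasurable (measurableSet_eq_fun (hF''m.comp hL_meas) hf)).2 h1
  have h3 : ∀ᵐ y ∂(volume : Measure (ι → ℝ)).restrict U, F'' (L y) = f y := hν.ae_le h2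
  filter_upwards [h3, ae_restrict_mem mU] with y hy hyU
  rw [hGeq y hyU, hy]

end OpenCube

end Summit.CriticalPhenomena.PercolationContinuityZ3.Theorems.SahiAEFourFunctions
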